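import Literature.NumberTheory.EllipticCurves.Rank1Residual.X9MuInvariant
import Literature.NumberTheory.EllipticCurves.IwasawaLambdaNorm
import Literature.NumberTheory.EllipticCurves.PAdicBSDProofs
import Literature.NumberTheory.EllipticCurves.PAdicLFunctionNeZeroHoldsProofs
import Literature.NumberTheory.EllipticCurves.LeadingTermPPartProofs
import Literature.NumberTheory.EllipticCurves.KatoFineSelmerDualProofs
import Literature.NumberTheory.EllipticCurves.IwasawaModuleFinitePadicIntProofs
import Literature.NumberTheory.EllipticCurves.Kato2004.DivisibilityInputsFine
import Literature.NumberTheory.EllipticCurves.Kato2004.IwasawaCohomologyExistsProofs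
import Literature.NumberTheory.EllipticCurves.TateModuleContinuityProofs
import HarnessLib

/-!
# `(μ, λ)` carriers of a pair `(E, p)`: the per-pair predicates "`μ^an = 0`", "`μ^an = m`",
# "`λ^an = ℓ`", "`μ^alg = 0`", "`μ^alg = m`", "`λ^alg = ℓ`" (Greenberg–Vatsal 2000 (1)–(3) transcribed)

Topic `NumberTheory/EllipticCurves/Rank1Residual` (namespace = path,
`Literature.NumberTheory.EllipticCurves.Rank1Residual`, alongside the pair predicates `GoodOrd`, `Irr`,
`Surj`, `ClassX9`, … of `Predicates.lean`).  DEFINITIONS ONLY (six `Prop`-valued PREDICATES on a pair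
`(W, p)`, each the verbatim transcription of a printed notion, cited) plus their unfolding / exactness
lemmas, all proved; NO named fact (nothing here is a closed `Prop` awaiting a `_holds`), NO conjecture,
nothing asserted about any curve.

Written by the typer seat of cell `bsd-f3-mu` (D-0131 (3) FRONTIER TIER, HOME
`run/shared/lean/pub/bsd-f3-mu/`; charter: «by what mechanism is `μ(L_p(E)) = 0 = μ(Sel)` when
`ρ̄_{E,p}` is irreducible but not surjective (X9: `5Ns`, `5S4`, `7Ns`; X10b: `3Ns`, `3Nn`), and can the
Greenberg–Vatsal congruence transfer be made image-free?»; director kickoff 2026-08-27: «(μ, λ) carriers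
for non-surjective image»).  The four lens planners of the cell type their candidate `Prop`s over THESE
names instead of re-spelling the binder blocks of `KatoMuTransfer` / `AnalyticMuZeroOnClassX9` (items
19629 / 19630 of route `SmallImageMuTransfer`, Summits side), and the cell's data table (two-engine
`(μ_an, λ_an)` per X9 / X10b pair) is the BC5 witness currency of `HasMuAnAt` / `HasLambdaAnAt`.  The
by-name bridges to those Summits-side nodes (and the EPW / GV transports in carrier currency) live in
`Summits/BirchSwinnertonDyer/Rank1Residual/SmallImageMu/TransportByName.lean`.

## The printed notions transcribed (Greenberg–Vatsal, Invent. Math. 142 (2000), pp. 1–4, read on the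
## tree's decode of `paper:arxiv-math_9906215`, as quoted in `GreenbergVatsal2000/CongruentCurves.lean`)

* (1)–(2): `X_E(ℚ_∞) ∼ (⊕ Λ/(fᵢ^{aᵢ})) ⊕ (⊕ Λ/(p^{μⱼ}))`, `λ^alg_E = Σ aᵢ deg fᵢ`, `μ^alg_E = Σ μⱼ`,
  "`p^{μ^alg_E}` is the exact power of `p` dividing `f^alg_E(T)` in `Λ`" — the tree's intrinsic
  `SelmerDualData.mu / lambda` (`IwasawaSelmer.lean`); here `MuAlgZeroAt`, `HasMuAlgAt`, `HasLambdaAlgAt`.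
* (3) and the Weierstrass-preparation sentence: "`L(E/ℚ,T) = p^{μ^anal_E}·u(T)·f(T)` where `f(T)` is a
  distinguished polynomial of degree `λ^anal_E`" — for the Mazur–Swinnerton-Dyer function
  `padicLFunction f α` of the tree (`PAdicLFunction.lean`): `MuAnZeroAt` (some coefficient a `p`-adic
  unit = `μ^anal = 0`, Greenberg–Vatsal (2) / Emerton–Pollack–Weston Def. 4.4.1), `HasMuAnAt m`
  ("`p^m` is the exact power of `p` dividing" the INTEGRAL `L ∈ Λ` with `ι L = L_p(f, α)` — it exists at
  an odd good ordinary `p` with `E[p]` irreducible, Prop. (3.7), tree theorem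
  `exists_iwasawaToPowerSeries_eq_padicLFunction`), `HasLambdaAnAt ℓ` (the Weierstrass degree, through
  the tree's norm-`λ` `normLam`, `IwasawaLambdaNorm.lean`, which is scaling-invariant — so no period
  normalisation enters).
* (the cell's SCOPE predicate `OrdinarySmallImageAt` = `ord(p) ∧ irr(p) ∧ ¬surj(p)` — X9 = this ∧
  ¬cm ∧ `p ≥ 5`, X10b = this at `p = 3` — is our own bookkeeping, not a printed notion: it lives
  Summits-side in `SmallImageMu/TransportByName.lean`.)

* (§3, appended 2026-08-27 for the cell's candidate es-C1 / C-imc-1) the per-pair forms of Kato's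
  Thm. 17.4 (3) CONCLUSION and of the BCS `μ`-defect: `KatoDivisibilityAt W p` ("`∃ g ∈ char_Λ X` with
  `ι g = L_p(f, α)`", the integral divisibility `char_Λ X ∣ L_p` as Kato prints it under surjectivity),
  `MuDefectNonposAt W p` / `MuDefectNonnegAt W p` (for BCS's exponent `k`, `ch X = (g)`, `ι g = p^k L_p`:
  `k ≤ 0` / `0 ≤ k`), with the proved per-pair equivalence `katoDivisibilityAt_iff_muDefectNonposAt`
  (Rohrlich one way, BCS (a) the other) and `muDefectNonnegAt_of_muAnZeroAt`.

Design notes. (a) `MuAnZeroAt`, `HasMuAnAt`, `HasLambdaAnAt` quantify over the newforms of `W` at ANY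
level, as `KatoMuTransfer` / `AnalyticMuZeroOnClassX9` do; Carayol (`IsNewformOf.level_eq_conductorNorm`,
cite-only) + `IsNewformOf.unique` identify them (`hasLambdaAnAt_iff_normLam_eq`). (b) No `ϖ` (Néron
normalisation `ϖ·Ω_E = Ω⁺_f`) appears: at `p ≥ 5` good with `E[p]` irreducible `‖ϖ‖_p = 1`
(`norm_periodRatio_eq_one`), and `normLam` is scaling-invariant anyway. (c) `MuAlgZeroAt` has no
cotorsion guard (the tree's `D.mu` is the junk `0` off the finitely generated torsion case, harmless for
"`= 0`"; this is the shape of every `hμ` binder in `X9MuInvariant.lean`); `HasMuAlgAt` / `HasLambdaAlgAt`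
carry `D.IsTorsion →`, as the print's standing "assume `Sel_E(ℚ_∞)_p` is `Λ`-cotorsion". (d) Junk:
`HasMuAnAt` is vacuous where no integral `L` exists (reducible `E[p]` with `μ^anal < 0`), `HasLambdaAnAt`
reads `normLam`'s junk `0` if no coefficient of maximal norm exists (never for `0 ≠ L_p ∈ Λ ⊗ ℚ`) —
both outside the good-ordinary irreducible scope, where `muAnZeroAt_iff_hasMuAnAt_zero` shows the carriers agree.

References: [GreenbergVatsal2000] (1)–(3), Prop. (3.7); [EmertonPollackWeston2006] §3.1, Def. 4.4.1,
Def. 4.4.6; [GreenbergLNM1716] §1 Conj. 1.11; [Washington1997] §7.1, §13.2.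
-/


noncomputable section

open scoped Classical MatrixGroups ModularForm

open CongruenceSubgroup WeierstrassCurve Literature.NumberTheory.EllipticCurves
  Literature.NumberTheory.EllipticCurves.ModularForms
  Literature.NumberTheory.EllipticCurves.GreenbergVatsal2000

namespace Literature.NumberTheory.EllipticCurves.Rank1Residual

/-! ### §1 Analytic carriers -/

section Analytic

/-- **`μ^an(E, p) = 0`**: for every newform `f` of `E = W` (any level), SOME coefficient of the
Mazur–Swinnerton-Dyer `p`-adic `L`-function `L_p(f, α)` (`α = unitRoot W p`; period `Ω⁺_f`) is a
`p`-adic unit — Greenberg–Vatsal's `μ^anal_E = 0` read through their (2) ("`p^μ` is the exact power of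
`p` dividing"), Emerton–Pollack–Weston's "unit content" (Def. 4.4.1).  Verbatim the per-pair body of the
Summits-side node `AnalyticMuZeroOnClassX9` and the certificate binder of `KatoMuTransfer`; decided per
pair by exact modular symbols. A predicate; nothing asserted.
[cite: GreenbergVatsal2000, pp. 3–4, (2)–(3) (definition of μ^anal; transcribed as a predicate)] -/
def MuAnZeroAt (W : WeierstrassCurve ℚ) [W.IsGloballyMinimal] (p : ℕ) [Fact p.Prime] : Prop :=
  ∀ {N : ℕ} [NeZero N] (f : CuspForm (Gamma0 N) 2), IsNewformOf W f →
    ∃ n : ℕ, ‖PowerSeries.coeff n (padicLFunction f (unitRoot W p : ℚ_[p]))‖ = 1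

/-- **`μ^an(E, p) = m`**: for every newform `f` of `W` and every INTEGRAL `L ∈ Λ = ℤ_p⟦T⟧` with
`ι L = L_p(f, α)`, `p^m` is the EXACT power of `p` dividing `L` in `Λ` (Greenberg–Vatsal (2) applied
to `L(E/ℚ, T)`).  Honest at an odd good ordinary `p` with `E[p]` irreducible, where such an `L` exists
and is unique (Greenberg–Vatsal Prop. (3.7): tree theorems
`exists(Unique)_iwasawaToPowerSeries_eq_padicLFunction`); vacuous (documented junk) where none exists.
A predicate; nothing asserted.
[cite: GreenbergVatsal2000, pp. 2–4, (2)–(3) and Prop. (3.7) (definition of μ^anal; transcribed as a predicate)] -/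
def HasMuAnAt (W : WeierstrassCurve ℚ) [W.IsGloballyMinimal] (p : ℕ) [Fact p.Prime] (m : ℕ) :
    Prop :=
  ∀ {N : ℕ} [NeZero N] (f : CuspForm (Gamma0 N) 2), IsNewformOf W f →
    ∀ L : IwasawaAlgebra p,
      iwasawaToPowerSeries p L = padicLFunction f (unitRoot W p : ℚ_[p]) →
      PowerSeries.C ((p : ℤ_[p]) ^ m) ∣ L ∧ ¬ PowerSeries.C ((p : ℤ_[p]) ^ (m + 1)) ∣ L

/-- **`λ^an(E, p) = ℓ`**: for every newform `f` of `W`, the norm-`λ`-invariant of `L_p(f, α)` — the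
least index of a coefficient of maximal `p`-adic norm (`normLam`, `IwasawaLambdaNorm.lean`; = the
Weierstrass degree of `p^{-μ} L_p`, Washington §7.1, Greenberg–Vatsal "`f(T)` distinguished of degree
`λ^anal_E`", Emerton–Pollack–Weston Def. 4.4.6) — equals `ℓ`.  Scaling-invariant, so independent of the
period normalisation. A predicate; nothing asserted.
[cite: GreenbergVatsal2000, pp. 3–4, (3) (definition of λ^anal; transcribed as a predicate)]
[cite: EmertonPollackWeston2006, Def. 4.4.6] -/
def HasLambdaAnAt (W : WeierstrassCurve ℚ) [W.IsGloballyMinimal] (p : ℕ) [Fact p.Prime] (ℓ : ℕ) :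
    Prop :=
  ∀ {N : ℕ} [NeZero N] (f : CuspForm (Gamma0 N) 2), IsNewformOf W f →
    normLam (padicLFunction f (unitRoot W p : ℚ_[p])) = ℓ

variable {W : WeierstrassCurve ℚ} [W.IsGloballyMinimal] {p : ℕ} [Fact p.Prime]

/-- `p ∤ L` in `Λ` iff `p^0 ∣ L ∧ p^1 ∤ L` (bookkeeping for `HasMuAnAt W p 0`). [folklore] -/
private theorem C_pow_zero_dvd_and_not_C_pow_one_dvd_iff (L : IwasawaAlgebra p) :
    (PowerSeries.C ((p : ℤ_[p]) ^ 0) ∣ L ∧ ¬ PowerSeries.C ((p : ℤ_[p]) ^ (0 + 1)) ∣ L) ↔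
      ¬ PowerSeries.C (p : ℤ_[p]) ∣ L := by
  simp

/-- **`μ^an = 0` as a certificate ⟺ `μ^an = 0` as an exact power**, at an odd good ordinary `p` with
`E[p]` irreducible: there the integral `L` exists (Greenberg–Vatsal Prop. 3.7, tree theorem
`exists_iwasawaToPowerSeries_eq_padicLFunction`), and "some coefficient of `ι L` is a unit" is
"`p ∤ L`" (`hasUnitContent_iff_not_C_dvd`). [cite: GreenbergVatsal2000, Prop. (3.7)] -/
theorem muAnZeroAt_iff_hasMuAnAt_zero [W.IsElliptic] (hp : p ≠ 2) (hord : IsOrdinaryAt W p)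
    (hirr : W.HasIrreducibleModPGaloisRep p) : MuAnZeroAt W p ↔ HasMuAnAt W p 0 := by
  constructor
  · intro h N _ f hf L hL
    rw [C_pow_zero_dvd_and_not_C_pow_one_dvd_iff, ← hasUnitContent_iff_not_C_dvd,
      hasUnitContent_iff_exists_norm_coeff_map_eq_one, hL]
    exact h f hf
  · intro h N _ f hf
    obtain ⟨L, hL⟩ := exists_iwasawaToPowerSeries_eq_padicLFunction hp hord hf hirr
    have hL' := h f hf L hL
    rw [C_pow_zero_dvd_and_not_C_pow_one_dvd_iff, ← hasUnitContent_iff_not_C_dvd,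
      hasUnitContent_iff_exists_norm_coeff_map_eq_one, hL] at hL'
    exact hL'

/-- **Reading `λ^an` off ONE newform**: granted Carayol's `N = N_E` (`hlev`, cite-only named fact),
all newforms of `W` coincide (`IsNewformOf.unique`), so `HasLambdaAnAt W p ℓ` is the single equation
`normLam (L_p(f, α)) = ℓ` for any one newform `f`. [cite: Carayol1986] -/
theorem hasLambdaAnAt_iff_normLam_eq [W.IsElliptic]
    (hlev : ∀ (N : ℕ) [NeZero N], IsNewformOf.level_eq_conductorNorm (N := N))
    {N : ℕ} [NeZero N] {f : CuspForm (Gamma0 N) 2} (hf : IsNewformOf W f) (ℓ : ℕ) :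
    HasLambdaAnAt W p ℓ ↔ normLam (padicLFunction f (unitRoot W p : ℚ_[p])) = ℓ := by
  constructor
  · intro h
    exact h f hf
  · intro h M _ f₁ hf₁
    obtain rfl : M = W.conductorNorm ℤ := hlev M hf₁
    obtain rfl : N = W.conductorNorm ℤ := hlev N hf
    obtain rfl : f₁ = f := hf₁.unique hf
    exact h

/-- The same for `μ^an`: one newform and one integral `L` decide `HasMuAnAt` (Carayol `hlev`; `ι`
injective). [cite: Carayol1986] -/
theorem hasMuAnAt_iff_of_eq [W.IsElliptic]
    (hlev : ∀ (N : ℕ) [NeZero N], IsNewformOf.level_eq_conductorNorm (N := N))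
    {N : ℕ} [NeZero N] {f : CuspForm (Gamma0 N) 2} (hf : IsNewformOf W f) {L : IwasawaAlgebra p}
    (hL : iwasawaToPowerSeries p L = padicLFunction f (unitRoot W p : ℚ_[p])) (m : ℕ) :
    HasMuAnAt W p m ↔
      PowerSeries.C ((p : ℤ_[p]) ^ m) ∣ L ∧ ¬ PowerSeries.C ((p : ℤ_[p]) ^ (m + 1)) ∣ L := by
  constructor
  · intro h
    exact h f hf L hL
  · intro h M _ f₁ hf₁ L₁ hL₁
    obtain rfl : M = W.conductorNorm ℤ := hlev M hf₁
    obtain rfl : N = W.conductorNorm ℤ := hlev N hf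
    obtain rfl : f₁ = f := hf₁.unique hf
    obtain rfl : L₁ = L := iwasawaToPowerSeries_injective p (hL₁.trans hL.symm)
    exact h

/-- On the scope at `p ≥ 5` the Néron-normalised certificate (the `ϖ`-shape consumed by the GV / EPW
facts and by `X9.bsdp_of_mu_eq_zero`) follows from `MuAnZeroAt`, because `‖ϖ‖_p = 1`
(`norm_periodRatio_eq_one`, from the period-unit fact `h5`). [cite: GreenbergVatsal2000, §3 Remark (3.4)] -/
theorem MuAnZeroAt.neron [W.IsElliptic] (h5 : realPeriodRat_eq_unit_mul_plusPeriod)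
    (hp : 5 ≤ p) (hgood : W.HasGoodReductionAtPrime p) (hirr : W.HasIrreducibleModPGaloisRep p)
    (h : MuAnZeroAt W p) {N : ℕ} [NeZero N] (f : CuspForm (Gamma0 N) 2) (hf : IsNewformOf W f)
    (ϖ : ℚ) (hϖ : (ϖ : ℝ) * W.realPeriodRat = plusPeriod f) :
    ∃ n : ℕ, ‖PowerSeries.coeff n
      (PowerSeries.C (ϖ : ℚ_[p]) * padicLFunction f (unitRoot W p : ℚ_[p]))‖ = 1 := by
  obtain ⟨n, hn⟩ := h f hf
  have hϖ1 : ‖(ϖ : ℚ_[p])‖ = 1 := norm_periodRatio_eq_one h5 W p hp hgood hirr f hf ϖ hϖ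
  exact ⟨n, by rw [PowerSeries.coeff_C_mul, norm_mul, hϖ1, one_mul, hn]⟩

end Analytic

/-! ### §2 Algebraic carriers -/

section Algebraic

/-- **`μ^alg(E, p) = 0`**: for the cyclotomic `ℤ_p`-extension `κ` of `ℚ`, a topological generator `γ`
matching the cyclotomic variable, and every Pontryagin-dual datum `D` of `Sel_{p^∞}(E/ℚ_∞)`
(`D.X = X_E(ℚ_∞)`), `D.mu = 0` — Greenberg–Vatsal's `μ^alg_E = 0` ((1): `μ^alg_E = Σ μⱼ`), Greenberg's
Conj. 1.11 at the pair when `E[p]` is irreducible.  Verbatim the conclusion of the Summits-side node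
`KatoMuTransfer` and the `hμ` binder of `X9MuInvariant.lean`.  No cotorsion guard (see module docstring
(c)). A predicate; nothing asserted.
[cite: GreenbergVatsal2000, p. 2, (1) (definition of μ^alg; transcribed as a predicate)] -/
def MuAlgZeroAt (W : WeierstrassCurve ℚ) (p : ℕ) [Fact p.Prime] : Prop :=
  ∀ (κ : ZpExtension ℚ p) (γ : Field.absoluteGaloisGroup ℚ),
    κ.IsCyclotomic → κ.IsTopGenerator γ → IsCyclotomicVariable p γ →
    ∀ D : W.SelmerDualData κ γ, D.mu = 0

/-- **`μ^alg(E, p) = m`** (cotorsion-guarded): for all cyclotomic data and every `Λ`-torsion dual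
datum `D`, `D.mu = m`. A predicate; nothing asserted.
[cite: GreenbergVatsal2000, p. 2, (1) (definition of μ^alg; transcribed as a predicate)] -/
def HasMuAlgAt (W : WeierstrassCurve ℚ) (p : ℕ) [Fact p.Prime] (m : ℕ) : Prop :=
  ∀ (κ : ZpExtension ℚ p) (γ : Field.absoluteGaloisGroup ℚ),
    κ.IsCyclotomic → κ.IsTopGenerator γ → IsCyclotomicVariable p γ →
    ∀ D : W.SelmerDualData κ γ, D.IsTorsion → D.mu = m

/-- **`λ^alg(E, p) = ℓ`** (cotorsion-guarded): for all cyclotomic data and every `Λ`-torsion dual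
datum `D`, `D.lambda = ℓ` (Greenberg–Vatsal (1): `λ^alg_E = Σ aᵢ deg fᵢ`). A predicate; nothing asserted.
[cite: GreenbergVatsal2000, p. 2, (1) (definition of λ^alg; transcribed as a predicate)] -/
def HasLambdaAlgAt (W : WeierstrassCurve ℚ) (p : ℕ) [Fact p.Prime] (ℓ : ℕ) : Prop :=
  ∀ (κ : ZpExtension ℚ p) (γ : Field.absoluteGaloisGroup ℚ),
    κ.IsCyclotomic → κ.IsTopGenerator γ → IsCyclotomicVariable p γ →
    ∀ D : W.SelmerDualData κ γ, D.IsTorsion → D.lambda = ℓ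

variable {W : WeierstrassCurve ℚ} {p : ℕ} [Fact p.Prime]

/-- `μ^alg = 0` (unguarded) gives the guarded `HasMuAlgAt W p 0` (unfolding of Greenberg–Vatsal (1)).
[cite: GreenbergVatsal2000, p. 2, (1)] -/
theorem MuAlgZeroAt.hasMuAlgAt_zero (h : MuAlgZeroAt W p) : HasMuAlgAt W p 0 :=
  fun κ γ hκ hγ hγ' D _ => h κ γ hκ hγ hγ' D

/-- Conversely, granted cotorsion for all cyclotomic data (a binder), `HasMuAlgAt W p 0` gives
`MuAlgZeroAt W p` (unfolding of Greenberg–Vatsal (1)). [cite: GreenbergVatsal2000, p. 2, (1)] -/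
theorem muAlgZeroAt_of_hasMuAlgAt_zero (h : HasMuAlgAt W p 0)
    (htors : ∀ (κ : ZpExtension ℚ p) (γ : Field.absoluteGaloisGroup ℚ),
      κ.IsCyclotomic → κ.IsTopGenerator γ → IsCyclotomicVariable p γ →
      ∀ D : W.SelmerDualData κ γ, D.IsTorsion) : MuAlgZeroAt W p :=
  fun κ γ hκ hγ hγ' D => h κ γ hκ hγ hγ' D (htors κ γ hκ hγ hγ' D)

/-- **Cotorsion on the scope at `p ≥ 5`** from Burungale–Castella–Skinner 2025 Thm. 1.1.2 (a) (`hBCS`,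
PUBLISHED named fact, clause 1), read at a newform supplied by modularity (`hmodP`).
[cite: BurungaleCastellaSkinner2025, Thm. 1.1.2 (a) (p. 2 of arXiv:2405.00270v2)] -/
theorem isTorsion_of_bcs [W.IsElliptic] [W.IsGloballyMinimal]
    (hBCS : burungale_castella_skinner_charIdeal_eq_padicLFunction)
    (hmodP : nonempty_modularParametrizationData) (hp : 5 ≤ p)
    (hgood : W.HasGoodReductionAtPrime p) (hord : ¬ (p : ℤ) ∣ W.frobeniusTrace p)
    (hirr : W.HasIrreducibleModPGaloisRep p) :
    ∀ (κ : ZpExtension ℚ p) (γ : Field.absoluteGaloisGroup ℚ),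
      κ.IsCyclotomic → κ.IsTopGenerator γ → IsCyclotomicVariable p γ →
      ∀ D : W.SelmerDualData κ γ, D.IsTorsion := by
  intro κ γ hκ hγ hγ' D
  haveI : NeZero (W.conductorNorm ℤ) := ⟨(W.conductorNorm_pos_holds).ne'⟩
  obtain ⟨Dm⟩ := hmodP W
  exact (hBCS W p κ γ Dm.f hp hgood hord hirr hκ hγ hγ' Dm.isNewformOf D).1

/-- `μ^alg = 0` ⟺ unit content of a generator of the characteristic ideal, per datum (re-export of
`GreenbergVatsal2000.mu_eq_zero_iff_hasUnitContent` in carrier position). [cite: GreenbergVatsal2000, p. 2, sentence after (2)] -/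
theorem MuAlgZeroAt.hasUnitContent_of_charIdeal_eq (h : MuAlgZeroAt W p)
    {κ : ZpExtension ℚ p} {γ : Field.absoluteGaloisGroup ℚ} (hκ : κ.IsCyclotomic)
    (hγ : κ.IsTopGenerator γ) (hγ' : IsCyclotomicVariable p γ) (D : W.SelmerDualData κ γ)
    [Module.Finite (IwasawaAlgebra p) D.X] (hX : D.IsTorsion) {g : IwasawaAlgebra p}
    (hg : D.charIdeal = Ideal.span {g}) : HasUnitContent g :=
  (mu_eq_zero_iff_hasUnitContent D hX hg).mp (h κ γ hκ hγ hγ' D)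

end Algebraic

/-! ### §3 Kato's divisibility and the BCS `μ`-defect, per pair (carriers of the cell's candidate es-C1) -/

section Defect

/-- **Kato's integral divisibility at `(E, p)`** — the CONCLUSION of Kato, Astérisque 295 (2004),
Thm. 17.4 (3) ("if `ρ_{E,p}` is surjective … the characteristic ideal of `X` divides `L_p` in `Λ`"),
transcribed per pair WITHOUT its image hypothesis, as a predicate: for all cyclotomic data, every
newform `f` of `W` and every dual Selmer datum `D`, some `g ∈ char_Λ X(E/ℚ_∞)` has `ι g = L_p(f, α)`.
At a pair with `ρ_{E,p^∞}` surjective this is clause 3 of the tree fact `kato_divisibility`; on the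
small-image scope it is the cell's OPEN candidate es-C1 (`KatoDivisibilityOnClassX9`, Summits side).
A predicate; nothing asserted. [cite: Kato2004Asterisque, Thm. 17.4 (3) (p. 273) (conclusion transcribed as a predicate)] -/
def KatoDivisibilityAt (W : WeierstrassCurve ℚ) [W.IsGloballyMinimal] (p : ℕ) [Fact p.Prime] :
    Prop :=
  ∀ (κ : ZpExtension ℚ p) (γ : Field.absoluteGaloisGroup ℚ) {N : ℕ} [NeZero N]
    (f : CuspForm (Gamma0 N) 2),
    κ.IsCyclotomic → κ.IsTopGenerator γ → IsCyclotomicVariable p γ → IsNewformOf W f →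
    ∀ D : W.SelmerDualData κ γ,
      ∃ g ∈ D.charIdeal, iwasawaToPowerSeries p g = padicLFunction f (unitRoot W p : ℚ_[p])

/-- **The `μ`-defect is `≤ 0` at `(E, p)`** (Kato's direction).  Burungale–Castella–Skinner 2025
Thm. 1.1.2 (a) gives `ch_Λ X = (g)` with `ι g = p^k · L_p(f, α)` for an integer `k` (their displays
(5.3)–(5.4): "in `Λ` if hypothesis (im) holds, and in `Λ ⊗ ℚ_p` otherwise"); `k = μ(X) − μ(L_p)` is
the whole integral defect.  The predicate: for all such data `(κ, γ, f, D, g, k)`, `k ≤ 0`.  A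
predicate; nothing asserted. [cite: BurungaleCastellaSkinner2025, Thm. 1.1.2 (a) and displays (5.3)–(5.4) (pp. 2, 10 of arXiv:2405.00270v2) (the exponent k, transcribed as a predicate)] -/
def MuDefectNonposAt (W : WeierstrassCurve ℚ) [W.IsGloballyMinimal] (p : ℕ) [Fact p.Prime] :
    Prop :=
  ∀ (κ : ZpExtension ℚ p) (γ : Field.absoluteGaloisGroup ℚ) {N : ℕ} [NeZero N]
    (f : CuspForm (Gamma0 N) 2),
    κ.IsCyclotomic → κ.IsTopGenerator γ → IsCyclotomicVariable p γ → IsNewformOf W f →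
    ∀ (D : W.SelmerDualData κ γ) (g : IwasawaAlgebra p) (k : ℤ),
      D.charIdeal = Ideal.span {g} →
      iwasawaToPowerSeries p g =
        PowerSeries.C ((p : ℚ_[p]) ^ k) * padicLFunction f (unitRoot W p : ℚ_[p]) →
      k ≤ 0

/-- **The `μ`-defect is `≥ 0` at `(E, p)`** (the Eisenstein / Greenberg direction, for ONE curve):
same data as `MuDefectNonposAt`, conclusion `0 ≤ k`, i.e. `μ(L_p(E)) ≤ μ(X(E/ℚ_∞))`.  A predicate;
nothing asserted. [cite: BurungaleCastellaSkinner2025, Thm. 1.1.2 (a) and displays (5.3)–(5.4) (pp. 2, 10 of arXiv:2405.00270v2) (the exponent k, transcribed as a predicate)] -/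
def MuDefectNonnegAt (W : WeierstrassCurve ℚ) [W.IsGloballyMinimal] (p : ℕ) [Fact p.Prime] :
    Prop :=
  ∀ (κ : ZpExtension ℚ p) (γ : Field.absoluteGaloisGroup ℚ) {N : ℕ} [NeZero N]
    (f : CuspForm (Gamma0 N) 2),
    κ.IsCyclotomic → κ.IsTopGenerator γ → IsCyclotomicVariable p γ → IsNewformOf W f →
    ∀ (D : W.SelmerDualData κ γ) (g : IwasawaAlgebra p) (k : ℤ),
      D.charIdeal = Ideal.span {g} →
      iwasawaToPowerSeries p g =
        PowerSeries.C ((p : ℚ_[p]) ^ k) * padicLFunction f (unitRoot W p : ℚ_[p]) →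
      0 ≤ k

variable {W : WeierstrassCurve ℚ} [W.IsGloballyMinimal] {p : ℕ} [Fact p.Prime]

/-- `|p^k|_p ≤ 1 ⟺ 0 ≤ k` in `ℚ_p`. [folklore] -/
private theorem zpow_norm_le_one_iff (k : ℤ) : ‖(p : ℚ_[p]) ^ k‖ ≤ 1 ↔ 0 ≤ k := by
  have hpP : p.Prime := Fact.out
  have hp1 : (1 : ℝ) < p := by exact_mod_cast hpP.one_lt
  rw [norm_zpow, Padic.norm_p, inv_zpow']
  constructor
  · intro h
    by_contra hlt
    push Not at hlt
    exact absurd h (not_le.mpr (one_lt_zpow₀ hp1 (by omega)))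
  · intro h
    exact zpow_le_one_of_nonpos₀ hp1.le (by omega)

/-- **Kato's divisibility at the pair ⟹ `μ`-defect `≤ 0`** (no main-conjecture input): if
`g' ∈ char X = (g)` with `ι g' = L_p` and `ι g = p^k L_p`, then `g' = h·g`, `L_p = ι(h)·p^k·L_p`,
and `L_p ≠ 0` (Rohrlich 1984, tree theorem `padicLFunction_unitRoot_ne_zero`) gives `ι(h)(0)·p^k = 1`
with `ι(h)(0) ∈ ℤ_p`, whence `k ≤ 0`. [cite: RohrlichInventiones1984, Theorem (p. 409)] -/
theorem KatoDivisibilityAt.muDefectNonposAt [W.IsElliptic] (hord : IsOrdinaryAt W p)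
    (h : KatoDivisibilityAt W p) : MuDefectNonposAt W p := by
  intro κ γ N _ f hκ hγ hγ' hf D g₀ k hg₀ hι₀
  have hpP : p.Prime := Fact.out
  obtain ⟨g, hg, hιg⟩ := h κ γ f hκ hγ hγ' hf D
  rw [hg₀] at hg
  obtain ⟨h', hh⟩ := Ideal.mem_span_singleton'.mp hg
  have hL : padicLFunction f (unitRoot W p : ℚ_[p]) ≠ 0 := padicLFunction_unitRoot_ne_zero hord hf
  have e1 : iwasawaToPowerSeries p h' * PowerSeries.C ((p : ℚ_[p]) ^ k) *
      padicLFunction f (unitRoot W p : ℚ_[p]) = 1 * padicLFunction f (unitRoot W p : ℚ_[p]) := by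
    rw [one_mul, mul_assoc, ← hι₀, ← map_mul, hh, hιg]
  have e2 : iwasawaToPowerSeries p h' * PowerSeries.C ((p : ℚ_[p]) ^ k) = 1 :=
    mul_right_cancel₀ hL e1
  have e3 := congrArg PowerSeries.constantCoeff e2
  simp only [map_mul, PowerSeries.constantCoeff_C, constantCoeff_iwasawaToPowerSeries, map_one] at e3
  have hn : ‖((PowerSeries.constantCoeff h' : ℤ_[p]) : ℚ_[p])‖ * ‖(p : ℚ_[p]) ^ k‖ = 1 := by
    rw [← norm_mul, e3, norm_one]
  have hh1 : ‖((PowerSeries.constantCoeff h' : ℤ_[p]) : ℚ_[p])‖ ≤ 1 := by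
    rw [PadicInt.padic_norm_e_of_padicInt]; exact PadicInt.norm_le_one _
  have hpk : 1 ≤ ‖(p : ℚ_[p]) ^ k‖ := by
    by_contra hlt
    push Not at hlt
    have := mul_lt_mul' hh1 hlt (norm_nonneg _) one_pos
    rw [hn, one_mul] at this
    exact lt_irrefl _ this
  have hneg : ‖(p : ℚ_[p]) ^ (-k)‖ ≤ 1 := by
    rw [zpow_neg, norm_inv]
    exact inv_le_one_of_one_le₀ hpk
  have := (zpow_norm_le_one_iff (p := p) (-k)).mp hneg
  omega

/-- **`μ`-defect `≤ 0` + BCS Thm. 1.1.2 (a) ⟹ Kato's divisibility at the pair** (`p ≥ 5` good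
ordinary, `E[p]` irreducible): with `ch X = (g)`, `ι g = p^k L_p`, `k ≤ 0`, the element `p^{-k}·g ∈ (g)`
has `ι(p^{-k} g) = L_p`. [cite: BurungaleCastellaSkinner2025, Thm. 1.1.2 (a) (p. 2 of arXiv:2405.00270v2)] -/
theorem MuDefectNonposAt.katoDivisibilityAt [W.IsElliptic]
    (hBCS : burungale_castella_skinner_charIdeal_eq_padicLFunction) (hp : 5 ≤ p)
    (hgood : W.HasGoodReductionAtPrime p) (hord : ¬ (p : ℤ) ∣ W.frobeniusTrace p)
    (hirr : W.HasIrreducibleModPGaloisRep p) (h : MuDefectNonposAt W p) : KatoDivisibilityAt W p := by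
  intro κ γ N _ f hκ hγ hγ' hf D
  have hpP : p.Prime := Fact.out
  have hp0 : (p : ℚ_[p]) ≠ 0 := by exact_mod_cast hpP.ne_zero
  obtain ⟨-, g₀, k, hg₀, hι₀⟩ := hBCS W p κ γ f hp hgood hord hirr hκ hγ hγ' hf D
  have hk : k ≤ 0 := h κ γ f hκ hγ hγ' hf D g₀ k hg₀ hι₀
  refine ⟨PowerSeries.C ((p : ℤ_[p]) ^ (-k).toNat) * g₀, ?_, ?_⟩
  · rw [hg₀]
    exact Ideal.mul_mem_left _ _ (Ideal.mem_span_singleton_self g₀)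
  · rw [map_mul, hι₀, ← mul_assoc]
    have hC : iwasawaToPowerSeries p (PowerSeries.C ((p : ℤ_[p]) ^ (-k).toNat)) =
        PowerSeries.C ((p : ℚ_[p]) ^ (-k)) := by
      rw [iwasawaToPowerSeries, PowerSeries.map_C, map_pow, map_natCast, ← zpow_natCast,
        Int.toNat_of_nonneg (by omega)]
    rw [hC, ← map_mul, ← zpow_add₀ hp0, neg_add_cancel, zpow_zero, map_one, one_mul]

/-- **Per pair, on the scope at `p ≥ 5`: Kato's divisibility ⟺ `μ`-defect `≤ 0`** (granted BCS
Thm. 1.1.2 (a) for ⟸). [cite: BurungaleCastellaSkinner2025, Thm. 1.1.2 (a) (p. 2 of arXiv:2405.00270v2)] -/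
theorem katoDivisibilityAt_iff_muDefectNonposAt [W.IsElliptic]
    (hBCS : burungale_castella_skinner_charIdeal_eq_padicLFunction) (hp : 5 ≤ p)
    (hgood : W.HasGoodReductionAtPrime p) (hord : ¬ (p : ℤ) ∣ W.frobeniusTrace p)
    (hirr : W.HasIrreducibleModPGaloisRep p) : KatoDivisibilityAt W p ↔ MuDefectNonposAt W p :=
  ⟨fun h => h.muDefectNonposAt ⟨hgood, hord⟩,
    fun h => h.katoDivisibilityAt hBCS hp hgood hord hirr⟩

/-- **`μ^an(E, p) = 0` ⟹ `μ`-defect `≥ 0`** (the easy direction: a unit coefficient of `L_p` and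
`ι g = p^k L_p` with `g ∈ Λ` give `|p^k|_p ≤ 1`). [cite: GreenbergVatsal2000, p. 2, (2)] -/
theorem MuAnZeroAt.muDefectNonnegAt (h : MuAnZeroAt W p) : MuDefectNonnegAt W p := by
  intro κ γ N _ f hκ hγ hγ' hf D g k hg hι
  obtain ⟨n, hn⟩ := h f hf
  have hcoeff := congrArg (PowerSeries.coeff n) hι
  rw [PowerSeries.coeff_C_mul] at hcoeff
  have h1 : ‖PowerSeries.coeff n (iwasawaToPowerSeries p g)‖ ≤ 1 := by
    rw [PowerSeries.coeff_map]
    exact (PowerSeries.coeff n g).norm_le_one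
  rw [hcoeff, norm_mul, hn, mul_one] at h1
  exact (zpow_norm_le_one_iff (p := p) k).mp h1

/-- **`μ`-defect `≤ 0` and `≥ 0` at the pair ⟹ the integral main conjecture at the pair** (granted BCS
Thm. 1.1.2 (a)): `k = 0`, so the BCS generator `g` has `ι g = L_p(f, α)`.
[cite: BurungaleCastellaSkinner2025, Thm. 1.1.2 (a) (p. 2 of arXiv:2405.00270v2)] -/
theorem integralMainConjectureAt_of_muDefect [W.IsElliptic]
    (hBCS : burungale_castella_skinner_charIdeal_eq_padicLFunction) (hp : 5 ≤ p)
    (hgood : W.HasGoodReductionAtPrime p) (hord : ¬ (p : ℤ) ∣ W.frobeniusTrace p)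
    (hirr : W.HasIrreducibleModPGaloisRep p) (hle : MuDefectNonposAt W p) (hge : MuDefectNonnegAt W p)
    (κ : ZpExtension ℚ p) (γ : Field.absoluteGaloisGroup ℚ) {N : ℕ} [NeZero N]
    (f : CuspForm (Gamma0 N) 2) (hκ : κ.IsCyclotomic) (hγ : κ.IsTopGenerator γ)
    (hγ' : IsCyclotomicVariable p γ) (hf : IsNewformOf W f) (D : W.SelmerDualData κ γ) :
    D.IsTorsion ∧ ∃ g : IwasawaAlgebra p, D.charIdeal = Ideal.span {g} ∧
      iwasawaToPowerSeries p g = padicLFunction f (unitRoot W p : ℚ_[p]) := by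
  obtain ⟨htors, g, k, hg, hι⟩ := hBCS W p κ γ f hp hgood hord hirr hκ hγ hγ' hf D
  have h1 : k ≤ 0 := hle κ γ f hκ hγ hγ' hf D g k hg hι
  have h2 : 0 ≤ k := hge κ γ f hκ hγ hγ' hf D g k hg hι
  have hk : k = 0 := le_antisymm h1 h2
  refine ⟨htors, g, hg, ?_⟩
  rw [hι, hk, zpow_zero, map_one, one_mul]

end Defect

/-! ### §4 The Teichmüller-orbit carrier (the analytic `μ = 0` in FINITE modular-symbol currency)

Mazur–Tate–Teitelbaum §I.10: `μ_{f,α}(a + pⁿℤ_p) = α⁻ⁿ[a/pⁿ]⁺ − α⁻⁽ⁿ⁺¹⁾[a/pⁿ⁻¹]⁺` (tree `msdMeasure`,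
(10.1)) with the distribution relation (10.2).  Summing over the Teichmüller orbit
`{η a : η^{p−1} = 1}` of `a ∈ (ℤ/pⁿ)^×` gives the Riemann sums `ν_n(a) = Σ_η μ_{f,α}(ηa + pⁿℤ_p)` of
the `ω⁰`-branch, and `μ(L_p(f,α)) = 0` iff some `ν_n(a)` is a `p`-adic unit; in the PRINTED `ν`-form
(Chakravarthy 2024, eqn. (1) p. 6; Pollack–Weston 2011 Prop. 3.7 via Mazur–Tate elements) this is a
finite criterion on the rational plus symbols `[b/pⁿ]⁺_f`.  The cell's `-an` lens (MEMO-an §3) telescopes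
the `α`'s away: with `S_f(p,n,a) := Σ_{η^{p−1}=1} [ηa/pⁿ]⁺_f ∈ ℚ`, «`μ(L_p) > 0` ⟺ for every `n ≥ 1`
the map `a ↦ S_f(p,n,a) mod p` is constant on `(ℤ/pⁿ)^×`» on the `p`-INTEGRAL locus of `[·]⁺_f`.  Below:
the DEFINITION `teichOrbitSum` and the per-pair predicate `TeichOrbitNonConstantAt` (nothing asserted;
the equivalence with `MuAnZeroAt` is NOT claimed here — its two directions are the cell's paper bridges
AN-S1/AN-S2, which need the symbol integrality of Greenberg–Vatsal 2000 §3, not a tree fact today).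
NORMALISATION (one period throughout): `teichOrbitSum`, `msdMeasure` and `padicLFunction f` are ALL built
from the same `ratPlusSymbol f` (`[r]⁺_f = re({∞,r}+{∞,−r})/2 / Ω⁺_f`, `PAdicLFunction.lean`), so no
period ratio intervenes between `TeichOrbitNonConstantAt W p` and `MuAnZeroAt W p`. -/

section TeichOrbit

/-- **Teichmüller-orbit sum of plus symbols** `S_f(p, n, a) = Σ_{t ∈ ℤ/pⁿ, t^{p−1} = 1} [t·a/pⁿ]⁺_f ∈ ℚ`
(`[·]⁺_f = ratPlusSymbol f`, representative `(t a).val ∈ [0, pⁿ)` — immaterial since `[r+1]⁺ = [r]⁺`,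
`ratPlusSymbol_add_intCast_eq`).  For `n ≥ 1` the solutions of `t^{p−1} = 1` in `ℤ/pⁿ` are exactly the
`p − 1` Teichmüller representatives; in homology `S_f(p,n,a)` is the pairing of `φ_f⁺` with the
Teichmüller-orbit winding element `Σ_η {∞ → ηa/pⁿ}`.  A DEFINITION (the `-an` lens's object, MEMO-an §3;
verbatim `HOME/an/Sketch.lean`). [cite: MazurTateTeitelbaum1986Invent, §I.10 (10.1)–(10.2)] -/
def teichOrbitSum {N : ℕ} (f : CuspForm (Gamma0 N) 2) (p : ℕ) [Fact p.Prime] (n : ℕ)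
    (a : ZMod (p ^ n)) : ℚ :=
  ∑ t ∈ (Finset.univ : Finset (ZMod (p ^ n))).filter (fun t => t ^ (p - 1) = 1),
    ratPlusSymbol f (((t * a).val : ℚ) / (p : ℚ) ^ n)

/-- Unfolding lemma for `teichOrbitSum`. [cite: MazurTateTeitelbaum1986Invent, §I.10 (10.1)] -/
theorem teichOrbitSum_def {N : ℕ} (f : CuspForm (Gamma0 N) 2) (p : ℕ) [Fact p.Prime] (n : ℕ)
    (a : ZMod (p ^ n)) :
    teichOrbitSum f p n a =
      ∑ t ∈ (Finset.univ : Finset (ZMod (p ^ n))).filter (fun t => t ^ (p - 1) = 1),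
        ratPlusSymbol f (((t * a).val : ℚ) / (p : ℚ) ^ n) :=
  rfl

/-- The orbit sum of `a = 0` is `#{t : t^{p−1} = 1} · [0]⁺_f` (every term is `[0]⁺_f = L(f,1)/Ω⁺_f`).
[cite: MazurTateTeitelbaum1986Invent, §I.10 (10.1)] -/
theorem teichOrbitSum_zero {N : ℕ} (f : CuspForm (Gamma0 N) 2) (p : ℕ) [Fact p.Prime] (n : ℕ) :
    teichOrbitSum f p n 0 =
      ((Finset.univ : Finset (ZMod (p ^ n))).filter (fun t => t ^ (p - 1) = 1)).card •
        ratPlusSymbol f 0 := by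
  simp [teichOrbitSum, zero_div]

/-- **`TeichOrbitNonConstantAt W p`** — the per-pair carrier of the cell's candidate AN-1 (item 19630 in
finite modular-symbol currency): for every newform `f` of `W` (any level), at SOME level `pⁿ`, `n ≥ 1`,
two Teichmüller-orbit sums of plus symbols are NOT congruent mod `p` — spelled `1 ≤ ‖S(a) − S(a′)‖_p` for
units `a, a′` (the difference is nonzero of valuation `≤ 0`; at `n = 1` all orbits coincide, so a witness
has `n ≥ 2`).  Decided per pair by finitely many exact modular symbols.  JUNK NOTE (ref1/ref2): off the
`p`-integral locus of `[·]⁺_f` (`E[p]` reducible, e.g. `11a1 @ 5`, `[0]⁺ = 1/5`) a difference of orbit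
sums may have NEGATIVE valuation, so the predicate can hold while `μ^an > 0`; use it only with
`W.HasIrreducibleModPGaloisRep p`, `p ≥ 5` good, where it is equivalent to `MuAnZeroAt W p` by MTT
(10.1)–(10.2) + symbol integrality (the cell's paper bridges AN-S1/AN-S2 — NOT proved in the tree).  Same
period `Ω⁺_f` as `padicLFunction f` (section docstring).  A predicate; nothing asserted.  Verbatim
`HOME/an/Sketch.lean`.
[cite: MazurTateTeitelbaum1986Invent, §I.10 (10.1)–(10.2)]
[cite: Chakravarthy2024, eqn. (1) (p. 6 of arXiv:2408.07826) — the printed `ν`-form of the finite criterion]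
[cite: PollackWeston2011, Prop. 3.7] -/
def TeichOrbitNonConstantAt (W : WeierstrassCurve ℚ) [W.IsGloballyMinimal] (p : ℕ) [Fact p.Prime] :
    Prop :=
  ∀ {N : ℕ} [NeZero N] (f : CuspForm (Gamma0 N) 2), IsNewformOf W f →
    ∃ n : ℕ, 1 ≤ n ∧ ∃ a a' : (ZMod (p ^ n))ˣ,
      1 ≤ ‖((teichOrbitSum f p n (a : ZMod (p ^ n)) - teichOrbitSum f p n (a' : ZMod (p ^ n)) : ℚ) :
        ℚ_[p])‖

/-- `TeichOrbitNonConstantAt` at a FIXED newform (Carayol + multiplicity one: the newform of `W` is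
unique at level `N_E`, and there is none at other levels), mirroring `hasLambdaAnAt_iff_normLam_eq`.
[cite: MazurTateTeitelbaum1986Invent, §I.10] -/
theorem teichOrbitNonConstantAt_iff_of_isNewformOf {W : WeierstrassCurve ℚ} [W.IsElliptic]
    [W.IsGloballyMinimal] {p : ℕ} [Fact p.Prime]
    (hlev : ∀ (N : ℕ) [NeZero N], IsNewformOf.level_eq_conductorNorm (N := N)) {N : ℕ} [NeZero N]
    {f : CuspForm (Gamma0 N) 2} (hf : IsNewformOf W f) :
    TeichOrbitNonConstantAt W p ↔
      ∃ n : ℕ, 1 ≤ n ∧ ∃ a a' : (ZMod (p ^ n))ˣ,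
        1 ≤ ‖((teichOrbitSum f p n (a : ZMod (p ^ n)) - teichOrbitSum f p n (a' : ZMod (p ^ n)) : ℚ) :
          ℚ_[p])‖ := by
  constructor
  · intro h
    exact h f hf
  · intro h M _ f₁ hf₁
    obtain rfl : M = W.conductorNorm ℤ := hlev M hf₁
    obtain rfl : N = W.conductorNorm ℤ := hlev N hf
    obtain rfl : f₁ = f := hf₁.unique hf
    exact h

end TeichOrbit

/-! ### §5 Fine-Selmer carriers: statement (A) at a pair, pointwise `μ(X₀) = 0`, and the `μ`-defect bound
`k ≤ μ(X₀)` (Kato §17.13: `0 → P/loc 𝐇¹ → X → X₀ → 0`)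

Kato, Astérisque 295, §17.13 (pp. 279–280): with `X = X(E/ℚ_∞)` the dual Selmer module, `X₀ = X₀(E/ℚ_∞)`
the dual FINE Selmer module and `𝐇¹ = 𝐇¹_Γ(T_pE)`, the exact sequence `P/loc(𝐇¹) → X → X₀ → 0`, the
injectivity of the Coleman map and `col(loc z_Kato)·Λ_{(p)} ⊆ … ⊆ (L_p)·Λ_{(p)}` up to `(p)`-units
(irreducible `E[p]`) give `length_{(p)} X ≤ μ(L_p) + length_{(p)} X₀`, i.e. `μ(X) − μ(L_p) ≤ μ(X₀)` —
the mechanism of Wuthrich, MRL 13 (2006) Thm. 2 / Lemma 3 («char Y ∣ pᵗ·ind(c_∞) … p ∤ char Y ⟹ t = 0»),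
image-free beyond `Irr(E[p])`.  Hence Coates–Sujatha's statement (A) at the pair (`μ(X₀) = 0`) ALONE
forces the `μ`-defect `k ≤ 0` (§3 `MuDefectNonposAt`).  Below, per pair and with nothing asserted: the
PREDICATES `ConjAAt` (statement (A) at `(E, p)` over `ℚ^{cyc}`, the exact spelling of the hypothesis
`hA` of `Kato2004.rankZero_…_of_fineSelmerDual_fg` and of the conclusions of
`CoatesSujatha2005.thm34_…` / `DeoRaySujatha2023.thm39_…`), `FineMuZeroAt` (pointwise `μ(X₀) = 0`, the
fine analogue of `MuAlgZeroAt`), `MuDefectLeFineMuAt` (`k ≤ μ(X₀)`, a statement a prover closes from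
Kato's divisibility inputs `Kato2004.exists_divisibilityInputs_fineQuotient`), and the one-line bridge
`MuDefectLeFineMuAt ∧ FineMuZeroAt ⟹ MuDefectNonposAt`.  Cell record: `-desc` gen 1 (MEMO-desc §9,
`HOME/desc/Sketch2.lean` S-W⁺/T0 vocabulary, verbatim) and `-es` gen 1 (`HOME/es/Sketch2.lean` S-es-2
`FineMuZeroBoundsDefectAt` = the composite «`μ(X₀) = 0 ⟹ k ≤ 0`», subsumed by `MuDefectLeFineMuAt`; one
carrier filed for both). -/

section FineDefect

/-- **`ConjAAt W p` — statement (A) of Coates–Sujatha at the pair `(E, p)` over `ℚ^{cyc}`** (a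
PREDICATE on pairs — a property a given pair may or may not have; nothing is asserted about any pair):
for every cyclotomic `ℤ_p`-extension `κ` of `ℚ`, SOME dual datum of `Sel₀(ℚ_∞, E[p^∞])` (over some
topological generator) is finitely generated over `ℤ_p`.  Exactly the spelling of the CONCLUSIONS of the
typed facts `CoatesSujatha2005.thm34_…` / `DeoRaySujatha2023.thm39_…` (which prove it under class-group
hypotheses) and of the hypothesis `hA` of `Kato2004.rankZero_…_of_fineSelmerDual_fg`; its universal
closure over number fields is the general Summits-side obligation node of cell `bsd-littype` (seat 11),
instantiated on X9 in `Summits/…/SmallImageMu/ConjARoadEdges.lean`.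
[cite: CoatesSujatha2005, §3 statement (A) and Thm. 3.4 (where it is proved under `μ_p(ℚ(E[p])) = 0`)]
[cite: DeoRaySujatha2023, Thm. 3.9 (class-group criterion proving it per pair)] -/
def ConjAAt (W : WeierstrassCurve ℚ) [W.IsElliptic] (p : ℕ) [Fact p.Prime] : Prop :=
  ∀ (κ : ZpExtension ℚ p), κ.IsCyclotomic →
    ∃ (γ : Field.absoluteGaloisGroup ℚ) (D : W.FineSelmerDualData κ γ),
      Module.Finite ℤ_[p] (RestrictScalars ℤ_[p] (IwasawaAlgebra p) D.X)

/-- **`FineMuZeroAt W p` — pointwise `μ(X₀(E/ℚ_∞)) = 0`** (the fine analogue of the carrier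
`MuAlgZeroAt`; a PREDICATE on pairs, nothing asserted about any pair): every finitely generated torsion
dual datum of `Sel₀(ℚ_∞, E[p^∞])` over cyclotomic data has `μ = 0` (`muInvariant`).  The `μ`-reading of
statement (A) («equivalent to saying that its `μ`-invariant is zero», Lei–Sujatha 2021 §1);
`ConjAAt → FineMuZeroAt` (the underlying `ℤ_p`-module of every datum is `Hom(Sel₀, ℚ/ℤ)`) is a prover's
support item, not claimed here.
[cite: CoatesSujatha2005, §3 statement (A), `μ`-form; Thm. 3.4] [cite: Kato2004Asterisque, §13.8 and §17.13 (pp. 279–280)] -/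
def FineMuZeroAt (W : WeierstrassCurve ℚ) [W.IsElliptic] (p : ℕ) [Fact p.Prime] : Prop :=
  ∀ (κ : ZpExtension ℚ p) (γ : Field.absoluteGaloisGroup ℚ),
    κ.IsCyclotomic → κ.IsTopGenerator γ → IsCyclotomicVariable p γ →
    ∀ Y : W.FineSelmerDualData κ γ, Module.Finite (IwasawaAlgebra p) Y.X →
      Module.IsTorsion (IwasawaAlgebra p) Y.X → muInvariant p Y.X = 0

/-- **`MuDefectLeFineMuAt W p` — the `μ`-defect is bounded by the fine `μ`: `k ≤ μ(X₀)`** (cell support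
statement S-W⁺; a predicate, nothing asserted; to be PROVED from `Kato2004.exists_divisibilityInputs_fineQuotient`):
for all cyclotomic data `(κ, γ)`, every newform `f` of `W`, every dual Selmer datum `D` with
`ch_Λ X = (g)`, `ι g = p^k · L_p(f, α)`, and every finitely generated torsion dual fine datum `Y` over
the same data, `k ≤ μ(Y)`.  Paper proof (Kato §17.13 at the height-one prime `𝔭 = (p)`, keeping the
`(Λ/(G₁))_𝔭` term): `length_𝔭 X ≤ μ(G₁) + length_𝔭 X₀` with `ι G₁ = L_p`, `(g) = ch X`, `ι g = p^k ι G₁`.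
NO surjectivity / `τ` / image input beyond `Irr(E[p])`.  Verbatim `HOME/desc/Sketch2.lean`.
[cite: Kato2004Asterisque, §17.13 (pp. 279–280) — the exact sequence and the length count]
[cite: Wuthrich2006, Thm. 2 and Lemma 3 (p. 717) — the mechanism «char Y ∣ pᵗ·ind(c_∞), p ∤ char Y ⟹ t = 0»] -/
def MuDefectLeFineMuAt (W : WeierstrassCurve ℚ) [W.IsElliptic] [W.IsGloballyMinimal] (p : ℕ)
    [Fact p.Prime] : Prop :=
  ∀ (κ : ZpExtension ℚ p) (γ : Field.absoluteGaloisGroup ℚ) {N : ℕ} [NeZero N]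
    (f : CuspForm (Gamma0 N) 2),
    κ.IsCyclotomic → κ.IsTopGenerator γ → IsCyclotomicVariable p γ → IsNewformOf W f →
    ∀ (D : W.SelmerDualData κ γ) (Y : W.FineSelmerDualData κ γ) (g : IwasawaAlgebra p) (k : ℤ),
      Module.Finite (IwasawaAlgebra p) Y.X → Module.IsTorsion (IwasawaAlgebra p) Y.X →
      D.charIdeal = Ideal.span {g} →
      iwasawaToPowerSeries p g =
        PowerSeries.C ((p : ℚ_[p]) ^ k) * padicLFunction f (unitRoot W p : ℚ_[p]) →
      k ≤ (muInvariant p Y.X : ℤ)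

variable {W : WeierstrassCurve ℚ} [W.IsElliptic] [W.IsGloballyMinimal] {p : ℕ} [Fact p.Prime]

/-- **The fine bridge per pair: `k ≤ μ(X₀)` ∧ pointwise `μ(X₀) = 0` ⟹ `k ≤ 0`** (`MuDefectNonposAt`),
granted that over every cyclotomic datum SOME dual fine datum is finitely generated torsion (`hY`; Kato
Thm. 12.4 — supplied on the good ordinary scope from `exists_divisibilityInputs_fineQuotient` and the
torsion of `X`).  The cell's S-W / S-es-2 composite. [cite: Kato2004Asterisque, §17.13 (pp. 279–280)] -/
theorem MuDefectLeFineMuAt.muDefectNonposAt (hW : MuDefectLeFineMuAt W p) (h0 : FineMuZeroAt W p)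
    (hY : ∀ (κ : ZpExtension ℚ p) (γ : Field.absoluteGaloisGroup ℚ),
      κ.IsCyclotomic → κ.IsTopGenerator γ → IsCyclotomicVariable p γ →
      ∃ Y : W.FineSelmerDualData κ γ,
        Module.Finite (IwasawaAlgebra p) Y.X ∧ Module.IsTorsion (IwasawaAlgebra p) Y.X) :
    MuDefectNonposAt W p := by
  intro κ γ N _ f hκ hγ hγ' hf D g k hg hι
  obtain ⟨Y, hYf, hYt⟩ := hY κ γ hκ hγ hγ'
  have h := hW κ γ f hκ hγ hγ' hf D Y g k hYf hYt hg hι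
  have hμ : muInvariant p Y.X = 0 := h0 κ γ hκ hγ hγ' Y hYf hYt
  rw [hμ] at h
  exact_mod_cast h

/-- **`k ≤ μ(X₀)` ∧ `μ(Y) = 0` for ONE finitely generated torsion fine datum per cyclotomic datum ⟹
`k ≤ 0`** (the form the Euler-system road uses: its `μ(Y) = 0` comes datum by datum).
[cite: Kato2004Asterisque, §17.13 (pp. 279–280)] -/
theorem MuDefectLeFineMuAt.muDefectNonposAt_of_exists (hW : MuDefectLeFineMuAt W p)
    (hY : ∀ (κ : ZpExtension ℚ p) (γ : Field.absoluteGaloisGroup ℚ),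
      κ.IsCyclotomic → κ.IsTopGenerator γ → IsCyclotomicVariable p γ →
      ∃ Y : W.FineSelmerDualData κ γ, Module.Finite (IwasawaAlgebra p) Y.X ∧
        Module.IsTorsion (IwasawaAlgebra p) Y.X ∧ muInvariant p Y.X = 0) :
    MuDefectNonposAt W p := by
  intro κ γ N _ f hκ hγ hγ' hf D g k hg hι
  obtain ⟨Y, hYf, hYt, hμ⟩ := hY κ γ hκ hγ hγ'
  have h := hW κ γ f hκ hγ hγ' hf D Y g k hYf hYt hg hι
  rw [hμ] at h
  exact_mod_cast h

/-- **T0 — statement (A) at the pair ⟹ pointwise `μ(X₀) = 0`** (`ConjAAt W p → FineMuZeroAt W p`; no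
parity / reduction / image hypothesis), PROVED: some fine datum `D` is `ℤ_p`-finite ⟹ `Sel₀(ℚ_∞)[p]` is
finite (`IwasawaModuleFinitePadicInt.finite_pTorsion_of_fineSelmerDualData_moduleFinite`) ⟹ for ANY
datum `Y`, `Y.X/pY.X` is finite (`FineSelmerDualData.finite_quotient_augIdealP_of_finite_pTorsion`) ⟹
`Y.X` is `ℤ_p`-finite (`moduleFinite_padicInt_of_finite_quotient_augIdealP`) ⟹ `μ(Y.X) = 0` for
finitely generated torsion `Y.X` (Washington §13.2, `muInvariant_eq_zero_iff_holds`).  This is stub 2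
(`stub_fineMuZero_of_conjA`) of the registered line `conj-a-road-fine` on crux
stmt-BirchSwinnertonDyer-20547, found provable and written by the cell's refuter `-ref1` (g2,
`HOME/ref1/g2/T0Proof.lean`; refuters do not land positive statements, D-0016) — landed here verbatim
up to the last step. [cite: Washington1997, §13.2 (after Thm. 13.12)] [cite: LimSujatha2018, §3 (before Prop. 3.2)] -/
theorem ConjAAt.fineMuZeroAt {W : WeierstrassCurve ℚ} [W.IsElliptic] {p : ℕ} [Fact p.Prime]
    (hA : ConjAAt W p) : FineMuZeroAt W p := by
  intro κ γ hκ hγ hγ' Y hYf hYt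
  obtain ⟨γ', D, hD⟩ := hA κ hκ
  have hfin :=
    IwasawaModuleFinitePadicInt.finite_pTorsion_of_fineSelmerDualData_moduleFinite W κ D hD
  haveI : Module.Finite (IwasawaAlgebra p) Y.X := hYf
  have hZp : Module.Finite ℤ_[p] (RestrictScalars ℤ_[p] (IwasawaAlgebra p) Y.X) :=
    IwasawaModuleFinitePadicInt.moduleFinite_padicInt_of_finite_quotient_augIdealP p Y.X
      (Y.finite_quotient_augIdealP_of_finite_pTorsion hfin)
  exact (muInvariant_eq_zero_iff_holds p Y.X hYt).mpr hZp

/-- T0 in the shape of the line's stub (`∀ W p, p ≠ 2 → ConjAAt W p → FineMuZeroAt W p`; the parity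
binder is not needed). [cite: Washington1997, §13.2] -/
theorem fineMuZeroAt_of_conjAAt :
    ∀ (W : WeierstrassCurve ℚ) [W.IsElliptic] (p : ℕ) [Fact p.Prime],
      p ≠ 2 → ConjAAt W p → FineMuZeroAt W p :=
  fun _ _ _ _ _ hA => hA.fineMuZeroAt

/-- **Statement (A) at the pair ∧ `k ≤ μ(X₀)` ⟹ `k ≤ 0`** (T0 composed with the fine bridge), granted a
finitely generated torsion fine datum over every cyclotomic datum.
[cite: Kato2004Asterisque, §17.13 (pp. 279–280)] [cite: Washington1997, §13.2] -/
theorem MuDefectLeFineMuAt.muDefectNonposAt_of_conjAAt {W : WeierstrassCurve ℚ} [W.IsElliptic]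
    [W.IsGloballyMinimal] {p : ℕ} [Fact p.Prime] (hW : MuDefectLeFineMuAt W p) (hA : ConjAAt W p)
    (hY : ∀ (κ : ZpExtension ℚ p) (γ : Field.absoluteGaloisGroup ℚ),
      κ.IsCyclotomic → κ.IsTopGenerator γ → IsCyclotomicVariable p γ →
      ∃ Y : W.FineSelmerDualData κ γ,
        Module.Finite (IwasawaAlgebra p) Y.X ∧ Module.IsTorsion (IwasawaAlgebra p) Y.X) :
    MuDefectNonposAt W p :=
  hW.muDefectNonposAt hA.fineMuZeroAt hY

end FineDefect

/-! ### §6 The per-pair engine of the Conj-A road: (A) at the pair + `k ≤ μ(X₀)` ⟹ the crux AT THE PAIR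

For the data seat and the route's BC5 witnesses: at a pair `p ≥ 5`, good ordinary, `E[p]` irreducible,
statement (A) (`ConjAAt`, certified per pair by class groups — Coates–Sujatha Thm 3.4 /
Deo–Ray–Sujatha Thm 3.9 / Fukuda) together with the provable bound `MuDefectLeFineMuAt` (`k ≤ μ(X₀)`,
Kato §17.13) gives the `μ`-defect `k ≤ 0` (`MuDefectNonposAt`) and hence Kato's integral divisibility
`KatoDivisibilityAt` at the pair — the per-pair instance of the cell's crux.  The only extra input is
the existence of a finitely generated torsion fine datum over every cyclotomic datum, discharged here
from Kato's divisibility inputs with the fine quotient (F1, `Kato2004.exists_divisibilityInputs_fineQuotient`: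
`X ↠ X₀`) and the torsion of `X` (BCS (a) clause 1, `isTorsion_of_bcs`). -/

section ConjARoadPerPair

variable {W : WeierstrassCurve ℚ} [W.IsElliptic] [W.IsGloballyMinimal] {p : ℕ} [Fact p.Prime]

/-- **Over every cyclotomic datum of a pair `p ≥ 5`, good ordinary, `E[p]` irreducible, SOME dual fine
Selmer datum is finitely generated and torsion over `Λ`** (Kato Thm. 12.4 on the scope): the pinned
datum is a quotient of `X(E/ℚ_∞)` (`Kato2004.exists_divisibilityInputs_fineQuotient`), which is
finitely generated (cyclotomic) and torsion (BCS (a) clause 1).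
[cite: Kato2004Asterisque, Thm. 12.4 and §17.13 (pp. 279–280)] [cite: BurungaleCastellaSkinner2025, Thm. 1.1.2 (a) (p. 2 of arXiv:2405.00270v2)] -/
theorem exists_fineSelmerDualData_finite_isTorsion (hmodP : nonempty_modularParametrizationData)
    (hfine : Kato2004.exists_divisibilityInputs_fineQuotient)
    (hBCS : burungale_castella_skinner_charIdeal_eq_padicLFunction)
    (hp : 5 ≤ p) (hgood : W.HasGoodReductionAtPrime p) (hord : ¬ (p : ℤ) ∣ W.frobeniusTrace p)
    (hirr : W.HasIrreducibleModPGaloisRep p) :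
    ∀ (κ : ZpExtension ℚ p) (γ : Field.absoluteGaloisGroup ℚ),
      κ.IsCyclotomic → κ.IsTopGenerator γ → IsCyclotomicVariable p γ →
      ∃ Y : W.FineSelmerDualData κ γ,
        Module.Finite (IwasawaAlgebra p) Y.X ∧ Module.IsTorsion (IwasawaAlgebra p) Y.X := by
  intro κ γ hκ hγ hγ'
  have hp2 : p ≠ 2 := by omega
  haveI : ContinuousSMul ℤ_[p] (W.tateModule p) := TateModule.continuousSMul_padicInt
  haveI : NeZero (W.conductorNorm ℤ) := ⟨(W.conductorNorm_pos_holds).ne'⟩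
  obtain ⟨Dm⟩ := hmodP W
  obtain ⟨I⟩ := Kato2004.nonempty_iwasawaH1Data_holds W p κ γ hκ hγ
  let D : W.SelmerDualData κ γ := W.selmerDualData κ hγ
  haveI : Module.Finite (IwasawaAlgebra p) D.X :=
    WeierstrassCurve.SelmerDualData.module_finite_of_isCyclotomic W κ hκ D hγ
  obtain ⟨Y⟩ := W.nonempty_fineSelmerDualData κ hγ
  obtain ⟨K, π, hπs, -⟩ := hfine W p Dm.f κ γ hp2 ⟨hgood, hord⟩ hκ hγ hγ' Dm.isNewformOf I D Y
  have hDt : D.IsTorsion := isTorsion_of_bcs hBCS hmodP hp hgood hord hirr κ γ hκ hγ hγ' D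
  exact ⟨Y, Module.Finite.of_surjective π hπs, Kato2004.isTorsion_of_surjective π hπs hDt⟩

/-- **(A) at the pair ∧ `k ≤ μ(X₀)` ⟹ `k ≤ 0`** at a pair `p ≥ 5`, good ordinary, `E[p]` irreducible
(T0 + the fine bridge + the discharged fine-datum guards). [cite: Kato2004Asterisque, §17.13 (pp. 279–280)] -/
theorem ConjAAt.muDefectNonposAt (hBCS : burungale_castella_skinner_charIdeal_eq_padicLFunction)
    (hmodP : nonempty_modularParametrizationData)
    (hfine : Kato2004.exists_divisibilityInputs_fineQuotient) (hp : 5 ≤ p)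
    (hgood : W.HasGoodReductionAtPrime p) (hord : ¬ (p : ℤ) ∣ W.frobeniusTrace p)
    (hirr : W.HasIrreducibleModPGaloisRep p) (hSW : MuDefectLeFineMuAt W p) (hA : ConjAAt W p) :
    MuDefectNonposAt W p :=
  hSW.muDefectNonposAt_of_conjAAt hA
    (exists_fineSelmerDualData_finite_isTorsion hmodP hfine hBCS hp hgood hord hirr)

/-- **The per-pair engine: (A) at the pair ∧ `k ≤ μ(X₀)` ⟹ Kato's integral divisibility at the pair**
(`KatoDivisibilityAt`, the crux `KatoDivisibilityOnClassX9` AT THE PAIR), at `p ≥ 5` good ordinary with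
`E[p]` irreducible, granted BCS (a), modularity and F1.  (A) is certified per pair by class groups
(`CoatesSujatha2005.thm34_…`, `DeoRaySujatha2023.thm39_…`, Fukuda); `k ≤ μ(X₀)` is Kato §17.13
bookkeeping.  [cite: Kato2004Asterisque, Thm. 17.4 (p. 273) and §17.13 (pp. 279–280)]
[cite: BurungaleCastellaSkinner2025, Thm. 1.1.2 (a) (p. 2 of arXiv:2405.00270v2)] -/
theorem ConjAAt.katoDivisibilityAt (hBCS : burungale_castella_skinner_charIdeal_eq_padicLFunction)
    (hmodP : nonempty_modularParametrizationData)
    (hfine : Kato2004.exists_divisibilityInputs_fineQuotient) (hp : 5 ≤ p)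
    (hgood : W.HasGoodReductionAtPrime p) (hord : ¬ (p : ℤ) ∣ W.frobeniusTrace p)
    (hirr : W.HasIrreducibleModPGaloisRep p) (hSW : MuDefectLeFineMuAt W p) (hA : ConjAAt W p) :
    KatoDivisibilityAt W p :=
  (hA.muDefectNonposAt hBCS hmodP hfine hp hgood hord hirr hSW).katoDivisibilityAt hBCS hp hgood
    hord hirr

end ConjARoadPerPair

end Literature.NumberTheory.EllipticCurves.Rank1Residual

end
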